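import Literature.Topology.FourManifolds.TraceCircleStraighten
import Literature.Topology.FourManifolds.CircleGermStraightLine
import Literature.Topology.FourManifolds.StraightLineAmbientIsotopySupport
import Literature.Topology.FourManifolds.WhitneyModelTransport
import Mathlib.Topology.MetricSpace.Thickening
import HarnessLib

/-!
# Straightening a boundary diffeomorphism near the trace circles (the normal step)

Topic `Literature/Topology/FourManifolds` (support file for the Torelli half of Griffiths'
handlebody theorem, `stmt-SmoothPoincare4-15190`, after `TraceCircleStraighten.lean`,
`CircleGermStraightLine.lean`).  Everything here is **proved**; no definitions besides the
germ of a boundary diffeomorphism in flow-polar coordinates.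

Hirsch, *Differential Topology* (1976), Ch. 8 §1, Thm. 1.3 and Ch. 4 §5: an embedding which
is the identity *on* a compact submanifold is isotopic, by an ambient isotopy supported near it,
to one which is a prescribed normal form *near* it, through the straight-line isotopy when the
derivatives `id + t (DP - id)` stay injective.  For a pair of basin settings `P` with saddle
data `Q` on a compact `3`-manifold with boundary (all saddles of index `1`) and a boundary
diffeomorphism `χ` which in flow-polar coordinates (`TracePolarChart.lean`) is the identity *on*
every trace circle (the output of `TraceCircleStraighten.lean`) and preserves the sides of the
circles (`⟪DF_s(z) z, z⟫ > 0` for the germs `F_s = polInv'_{σ s} ∘ χ ∘ pol_s`):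

* `SaddleData.exists_ambientIsotopy_normalStraighten` — there is an ambient isotopy `Φ` of
  `∂W`, supported in the sources of the charts `pol'`, fixing every `ξ_B`-trace circle pointwise
  at time one, with `Φ₁ (pol'_{σ s} w) = χ (pol_s w)` for all `w` in a neighbourhood
  `{x₁(w)² < δ}` of the unit circle (the straight-line isotopy of `F_s` in the plane,
  `exists_ambientIsotopy_of_straightLine_of_subset`, pushed to `∂W` along the chart
  `pol'_{σ s}`, `exists_ambientIsotopy_chartTransport_of_isCompact`, and composed over the
  saddles, `AmbientIsotopyFamily.lean`);
* `SaddleData.rigid_trans_symm_of_normalStraighten` — consequently `Φ₁⁻¹ ∘ χ` is **rigid at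
  every saddle** (`TracePolarRigid.rigid_of_pol_eq`), the hypothesis of the two-field endgame
  theorem `PairEndgame.lean`.

## References

* M. W. Hirsch, *Differential Topology*, GTM 33 (1976), Ch. 8 §1, Thm. 1.3; Ch. 4 §5.
  [HirschDT1976]
* H. B. Griffiths, *Automorphisms of a 3-dimensional handlebody*, Abh. Math. Sem. Univ. Hamburg
  26 (1964), §3. [GriffithsHB1964Handlebody]
-/

open scoped Manifold ContDiff Topology RealInnerProductSpace
open Set Function Filter Metric

noncomputable section

namespace Literature.Topology.FourManifolds

open Cobordism FourManifolds.Flow TracePolar CircleGerm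

universe u

namespace BasinPair

namespace SaddleData

variable {W : Type u} [TopologicalSpace W] [T2Space W] [SecondCountableTopology W]
  [CompactSpace W] [ChartedSpace (EuclideanHalfSpace (2 + 1)) W] [IsManifold (𝓡∂ (2 + 1)) ∞ W]
  {g : W → ℝ} {ξA ξB : Π x : W, TangentSpace (𝓡∂ (2 + 1)) x} {P : BasinPair g ξA ξB}
  (Q : P.SaddleData) [Nonempty (BoundaryManifold.boundaryData 2 W).carrier]

/-- Local notation for the model plane. -/
local notation "E2" => EuclideanSpace ℝ (Fin 2)

/-! ### The germ of a boundary map in flow-polar coordinates -/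

/-- **The germ of `χ` at the saddle `s` in flow-polar coordinates**: `polInv'_{σ s} ∘ χ ∘ pol_s`,
a self-map of the plane (meaningful near the unit circle). [cite: GriffithsHB1964Handlebody, §3] -/
def germ (χ : (𝓡∂ (2 + 1)).boundary W → (𝓡∂ (2 + 1)).boundary W) (s : SaddlePt 2 g) (w : E2) : E2 :=
  Q.swap.polInv (Q.σ s) (χ (Q.pol s w))

/-- The domain of the germ: flow-polar points of `s` mapped into the source of the chart of `σ s`. [folklore] -/
def germDom (χ : (𝓡∂ (2 + 1)).boundary W → (𝓡∂ (2 + 1)).boundary W) (s : SaddlePt 2 g) : Set E2 :=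
  {w | w ∈ Q.polTarget ∧ χ (Q.pol s w) ∈ Q.swap.polSource (Q.σ s)}

variable {Q}
variable (hk : ∀ s, (Q.DA s).k = 1) {χ : (𝓡∂ (2 + 1)).boundary W ≃ₘ⟮𝓡 2, 𝓡 2⟯ (𝓡∂ (2 + 1)).boundary W}

/-- `germ_def`. [folklore] -/
theorem germ_def (s : SaddlePt 2 g) (w : E2) : Q.germ χ s w = Q.swap.polInv (Q.σ s) (χ (Q.pol s w)) := rfl

include hk in
/-- The domain of the germ is open. [folklore] -/
theorem isOpen_germDom (s : SaddlePt 2 g) : IsOpen (Q.germDom χ s) := by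
  have hc : ContinuousOn (fun w => χ (Q.pol s w)) Q.polTarget := fun w hw =>
    (χ.continuous.continuousAt.comp (contMDiffAt_pol (hk s) hw).continuousAt).continuousWithinAt
  exact hc.isOpen_inter_preimage Q.isOpen_polTarget (Q.swap.isOpen_polSource _)

include hk in
/-- **The germ is smooth on its domain.** [folklore] -/
theorem contDiffOn_germ (s : SaddlePt 2 g) : ContDiffOn ℝ ∞ (Q.germ χ s) (Q.germDom χ s) := by
  intro w hw
  have h1 : ContMDiffAt 𝓘(ℝ, E2) (𝓡 2) ∞ (fun w => χ (Q.pol s w)) w :=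
    χ.contMDiff.contMDiffAt.comp w (contMDiffAt_pol (hk s) hw.1)
  have h2 : ContMDiffAt 𝓘(ℝ, E2) 𝓘(ℝ, E2) ∞ (Q.germ χ s) w :=
    (contMDiffAt_polInv (k_swap_eq_one Q hk _) hw.2).comp w h1
  exact (contMDiffAt_iff_contDiffAt.1 h2).contDiffWithinAt

include hk in
/-- **If `χ` is the identity in flow-polar coordinates on the trace circle, the germ fixes the
unit circle pointwise** and the circle lies in the domain. [folklore] -/
theorem germ_of_norm_eq_one (hC : ∀ s (u : E2), ‖u‖ = 1 → χ (Q.pol s u) = Q.swap.pol (Q.σ s) u)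
    (s : SaddlePt 2 g) {u : E2} (hu : ‖u‖ = 1) : Q.germ χ s u = u ∧ u ∈ Q.germDom χ s := by
  have hu' : u ∈ Q.polTarget := Q.mem_polTarget_of_norm_eq_one hu
  have hk' := k_swap_eq_one Q hk (Q.σ s)
  rw [germ_def, hC s u hu]
  exact ⟨polInv_pol hk' hu', hu', by rw [hC s u hu]; exact pol_mem_polSource hk' hu'⟩

/-! ### Thin annuli about the unit circle -/

omit [Nonempty (BoundaryManifold.boundaryData 2 W).carrier] in
/-- **Thin flow-polar annuli shrink to the unit circle**: for every open `V` containing the unit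
circle there is `δ ∈ (0, ε²]` with `{w ≠ 0, x₁(w)² < δ} ⊆ V`. [folklore] -/
theorem exists_annulus_subset (Q : P.SaddleData) {V : Set E2} (hV : IsOpen V) (hCV : Metric.sphere (0 : E2) 1 ⊆ V) :
    ∃ δ : ℝ, 0 < δ ∧ δ ≤ Q.ε ^ 2 ∧ ∀ w : E2, w ≠ 0 → xco Q.ε w ^ 2 < δ → w ∈ V := by
  have hε := Q.ε_pos
  obtain ⟨η, hη, hsub⟩ := (isCompact_sphere (0 : E2) 1).exists_thickening_subset_open hV hCV
  refine ⟨min (Q.ε ^ 2) ((η * Q.ε / 2) ^ 2), lt_min (pow_pos hε 2) (by positivity), min_le_left _ _, ?_⟩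
  intro w hw hx
  have hr : 0 < ‖w‖ := norm_pos_iff.2 hw
  apply hsub
  rw [Metric.mem_thickening_iff]
  refine ⟨‖w‖⁻¹ • w, by simp [norm_smul, hr.ne'], ?_⟩
  -- `dist w (w/‖w‖) = |‖w‖ - 1| ≤ |‖w‖ - ‖w‖⁻¹| = 2 |x₁(w)| / ε < η`
  have hd : dist w (‖w‖⁻¹ • w) = |‖w‖ - 1| := by
    rw [dist_eq_norm, show w - ‖w‖⁻¹ • w = (1 - ‖w‖⁻¹) • w by rw [sub_smul, one_smul], norm_smul, Real.norm_eq_abs]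
    rw [show |1 - ‖w‖⁻¹| * ‖w‖ = |(1 - ‖w‖⁻¹) * ‖w‖| by rw [abs_mul, abs_of_pos hr]]
    congr 1; field_simp
  rw [hd]
  have h1 : |‖w‖ - 1| ≤ |‖w‖ - ‖w‖⁻¹| := by
    have h2 : ‖w‖ - ‖w‖⁻¹ = (‖w‖ - 1) * (1 + ‖w‖⁻¹) := by field_simp; ring
    rw [h2, abs_mul, abs_of_pos (by positivity : (0 : ℝ) < 1 + ‖w‖⁻¹)]
    have : 0 ≤ |‖w‖ - 1| := abs_nonneg _
    nlinarith [inv_pos.2 hr]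
  have h3 : xco Q.ε w ^ 2 < (η * Q.ε / 2) ^ 2 := hx.trans_le (min_le_right _ _)
  have h4 : |xco Q.ε w| < η * Q.ε / 2 := abs_lt_of_sq_lt_sq' h3 (by positivity) |>.2 |> fun h => by
    rw [abs_lt]; exact ⟨(abs_lt_of_sq_lt_sq' h3 (by positivity)).1, h⟩
  have h5 : |‖w‖ - ‖w‖⁻¹| = 2 * |xco Q.ε w| / Q.ε := by
    rw [xco, abs_div, abs_mul, abs_of_pos hε, abs_two]; field_simp
  calc |‖w‖ - 1| ≤ |‖w‖ - ‖w‖⁻¹| := h1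
    _ = 2 * |xco Q.ε w| / Q.ε := h5
    _ < 2 * (η * Q.ε / 2) / Q.ε := by gcongr
    _ = η := by field_simp

omit [Nonempty (BoundaryManifold.boundaryData 2 W).carrier] in
/-- The closed annulus `{1/2 ≤ ‖w‖ ≤ 2}` is compact and lies in the flow-polar target. [folklore] -/
theorem isCompact_annulus_subset (Q : P.SaddleData) :
    IsCompact {w : E2 | 1 / 2 ≤ ‖w‖ ∧ ‖w‖ ≤ 2} ∧ {w : E2 | 1 / 2 ≤ ‖w‖ ∧ ‖w‖ ≤ 2} ⊆ Q.polTarget := by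
  constructor
  · have h1 : {w : E2 | 1 / 2 ≤ ‖w‖ ∧ ‖w‖ ≤ 2} = Metric.closedBall (0 : E2) 2 ∩ {w | 1 / 2 ≤ ‖w‖} := by
      ext w; simp [and_comm]
    rw [h1]
    exact (isCompact_closedBall _ _).inter_right (isClosed_le continuous_const continuous_norm)
  · intro w hw
    have hr : 0 < ‖w‖ := by linarith [hw.1]
    refine ⟨norm_pos_iff.1 hr, ?_⟩
    have hε := Q.ε_pos
    -- `|r - r⁻¹| ≤ 3/2 < 2` on the annulus
    have hb : |‖w‖ - ‖w‖⁻¹| ≤ 3 / 2 := by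
      rw [abs_le]
      have h2 : ‖w‖⁻¹ ≤ 2 := by
        have h := inv_anti₀ (by norm_num : (0 : ℝ) < 1 / 2) hw.1
        norm_num at h; exact h
      have h3 : (1 : ℝ) / 2 ≤ ‖w‖⁻¹ := by rw [one_div]; exact inv_anti₀ hr hw.2
      constructor <;> linarith [hw.1, hw.2]
    have h4 : xco Q.ε w ^ 2 = Q.ε ^ 2 * (‖w‖ - ‖w‖⁻¹) ^ 2 / 4 := by rw [xco]; ring
    rw [h4]
    have h5 : (‖w‖ - ‖w‖⁻¹) ^ 2 ≤ (3 / 2) ^ 2 := by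
      rw [← sq_abs]; exact pow_le_pow_left₀ (abs_nonneg _) hb 2
    nlinarith [pow_pos hε 2]

omit [Nonempty (BoundaryManifold.boundaryData 2 W).carrier] in
/-- Points with `x₁(w)² < ε²/2` (and `w ≠ 0`) lie in the open annulus `{1/2 < ‖w‖ < 2}`. [folklore] -/
theorem mem_openAnnulus_of_xco_sq_lt (Q : P.SaddleData) {w : E2} (hw : w ≠ 0) (hx : xco Q.ε w ^ 2 < Q.ε ^ 2 / 2) :
    1 / 2 < ‖w‖ ∧ ‖w‖ < 2 := by
  have hε := Q.ε_pos
  have hr : 0 < ‖w‖ := norm_pos_iff.2 hw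
  have h4 : xco Q.ε w ^ 2 = Q.ε ^ 2 * (‖w‖ - ‖w‖⁻¹) ^ 2 / 4 := by rw [xco]; ring
  rw [h4] at hx
  have h5 : (‖w‖ - ‖w‖⁻¹) ^ 2 < 2 := by nlinarith [pow_pos hε 2]
  have h6 : |‖w‖ - ‖w‖⁻¹| < 3 / 2 := by
    have : (‖w‖ - ‖w‖⁻¹) ^ 2 < (3 / 2) ^ 2 := by nlinarith
    exact abs_lt_of_sq_lt_sq this (by norm_num)
  rw [abs_lt] at h6
  have hinv : ‖w‖ * ‖w‖⁻¹ = 1 := mul_inv_cancel₀ hr.ne'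
  constructor
  · by_contra h
    have h7 : ‖w‖ ≤ 1 / 2 := not_lt.1 h
    have h8 : 2 ≤ ‖w‖⁻¹ := by
      have h := inv_anti₀ hr h7
      norm_num at h; exact h
    linarith [h6.1]
  · by_contra h
    have h7 : 2 ≤ ‖w‖ := not_lt.1 h
    have h8 : ‖w‖⁻¹ ≤ 1 / 2 := by
      have h := inv_anti₀ two_pos h7
      rw [one_div]; exact h
    linarith [h6.2]

/-! ### The normal straightening at one saddle, in the plane -/

include hk in
/-- **The straight-line isotopy of the germ at one saddle.**  If `χ` is the identity in
flow-polar coordinates on the trace circle of `s` and the germ preserves the sides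
(`⟪DF_s(z) z, z⟫ > 0`), there are an ambient isotopy `G` of the plane, the identity off the open
annulus `{1/2 < ‖w‖ < 2}` and off the domain of the germ at all times, and `δ ∈ (0, ε²/2]` such
that `G₁ = F_s` on `{w ≠ 0, x₁(w)² < δ}`, which lies in the domain of the germ.
[cite: HirschDT1976, Ch. 8 §1, Thm. 1.3; Ch. 4 §5] -/
theorem exists_planeIsotopy_germ (hC : ∀ s (u : E2), ‖u‖ = 1 → χ (Q.pol s u) = Q.swap.pol (Q.σ s) u) (s : SaddlePt 2 g)
    (hpos : ∀ z : E2, ‖z‖ = 1 → 0 < ⟪fderiv ℝ (Q.germ χ s) z z, z⟫) :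
    ∃ (G : AmbientIsotopy 𝓘(ℝ, E2) E2) (δ : ℝ), 0 < δ ∧ δ ≤ Q.ε ^ 2 / 2 ∧
      (∀ t w, ¬ (1 / 2 < ‖w‖ ∧ ‖w‖ < 2 ∧ w ∈ Q.germDom χ s) → G.toFun t w = w) ∧
      (∀ w : E2, w ≠ 0 → xco Q.ε w ^ 2 < δ → G.toFun 1 w = Q.germ χ s w ∧ w ∈ Q.germDom χ s) := by
  set Z : Set E2 := Metric.sphere (0 : E2) 1 with hZ
  have hZc : IsCompact Z := isCompact_sphere _ _
  have hmemZ : ∀ {z : E2}, z ∈ Z ↔ ‖z‖ = 1 := fun {z} => by simp [hZ]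
  have hdom : IsOpen (Q.germDom χ s) := isOpen_germDom hk s
  have hZW : Z ⊆ Q.germDom χ s := fun z hz => (germ_of_norm_eq_one hk hC s (hmemZ.1 hz)).2
  have hP : ContDiffOn ℝ ∞ (Q.germ χ s) (Q.germDom χ s) := contDiffOn_germ hk s
  have hPZ : ∀ z ∈ Z, Q.germ χ s z = z := fun z hz => (germ_of_norm_eq_one hk hC s (hmemZ.1 hz)).1
  have hfix : ∀ w : E2, ‖w‖ = 1 → Q.germ χ s w = w := fun w hw => hPZ w (hmemZ.2 hw)
  have hD : ∀ z ∈ Z, HasFDerivAt (Q.germ χ s) (fderiv ℝ (Q.germ χ s) z) z := fun z hz =>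
    ((hP.contDiffAt (hdom.mem_nhds (hZW hz))).differentiableAt (by simp)).hasFDerivAt
  have hinj : ∀ z ∈ Z, ∀ t ∈ Icc (0 : ℝ) 1, Injective (slDeriv t (fderiv ℝ (Q.germ χ s) z)) := fun z hz t ht =>
    slDeriv_injective_of_inner_pos (hmemZ.1 hz)
      (fderiv_apply_circleTangent_of_eqOn_sphere hfix (hmemZ.1 hz) (hD z hz)) (hpos z (hmemZ.1 hz)) ht
  -- the support: the open annulus inside the domain
  set W' : Set E2 := {w | 1 / 2 < ‖w‖ ∧ ‖w‖ < 2 ∧ w ∈ Q.germDom χ s} with hW'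
  have hW'o : IsOpen W' := by
    have h1 : IsOpen {w : E2 | 1 / 2 < ‖w‖} := isOpen_lt continuous_const continuous_norm
    have h2 : IsOpen {w : E2 | ‖w‖ < 2} := isOpen_lt continuous_norm continuous_const
    have h3 : W' = {w : E2 | 1 / 2 < ‖w‖} ∩ ({w : E2 | ‖w‖ < 2} ∩ Q.germDom χ s) := by
      ext w; simp [hW']
    rw [h3]; exact h1.inter (h2.inter hdom)
  have hZW' : Z ⊆ W' := fun z hz => by
    have h := hmemZ.1 hz
    exact ⟨by rw [h]; norm_num, by rw [h]; norm_num, hZW hz⟩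
  obtain ⟨G, hG1, hGs, -⟩ := exists_ambientIsotopy_of_straightLine_of_subset hZc hdom hZW hP hPZ hD hinj hW'o hZW'
  -- a thin annulus inside `{G₁ = germ} ∩ W'`
  obtain ⟨V, hVo, hZV, hV⟩ : ∃ V : Set E2, IsOpen V ∧ Z ⊆ V ∧ ∀ y ∈ V, G.toFun 1 y = Q.germ χ s y := by
    obtain ⟨V, hV, hVo, hZV⟩ := mem_nhdsSet_iff_exists.1 hG1
    exact ⟨V, hV, hVo, fun y hy => hZV hy⟩
  obtain ⟨δ, hδ0, hδε, hδ⟩ := exists_annulus_subset Q (hVo.inter hW'o) (subset_inter hZV hZW')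
  refine ⟨G, min δ (Q.ε ^ 2 / 2), lt_min hδ0 (by have := Q.ε_pos; positivity), min_le_right _ _,
    fun t w hw => hGs t w (by simpa [hW'] using hw), fun w hw hx => ?_⟩
  have hmem := hδ w hw (hx.trans_le (min_le_left _ _))
  exact ⟨hV w hmem.1, hmem.2.2.2⟩

/-! ### The normal straightening -/

include hk in
/-- **The normal straightening of a boundary diffeomorphism which is the identity in flow-polar
coordinates on the trace circles and preserves their sides.**  There is an ambient isotopy `Φ`
of `∂W`, the identity off the sources of the charts `pol'_{s'}` at all times and mapping each
source into itself, whose time-one map fixes every `ξ_B`-trace circle pointwise and satisfies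
`Φ₁ (pol'_{σ s} w) = χ (pol_s w)` on a thin annulus `{w ≠ 0, x₁(w)² < δ_s}`, `δ_s ∈ (0, ε²]`.
[cite: HirschDT1976, Ch. 8 §1, Thm. 1.3; Ch. 4 §5] [cite: GriffithsHB1964Handlebody, §3] -/
theorem exists_ambientIsotopy_normalStraighten (hC : ∀ s (u : E2), ‖u‖ = 1 → χ (Q.pol s u) = Q.swap.pol (Q.σ s) u)
    (hpos : ∀ s (z : E2), ‖z‖ = 1 → 0 < ⟪fderiv ℝ (Q.germ χ s) z z, z⟫) :
    ∃ Φ : AmbientIsotopy (𝓡 2) ((𝓡∂ (2 + 1)).boundary W),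
      (∀ s, ∃ δ : ℝ, 0 < δ ∧ δ ≤ Q.ε ^ 2 ∧
        ∀ w : E2, w ≠ 0 → xco Q.ε w ^ 2 < δ → Φ.toFun 1 (Q.swap.pol (Q.σ s) w) = χ (Q.pol s w)) ∧
      (∀ s (u : E2), ‖u‖ = 1 → Φ.toFun 1 (Q.swap.pol (Q.σ s) u) = Q.swap.pol (Q.σ s) u) ∧
      (∀ t y, (∀ s', y ∉ Q.swap.polSource s') → Φ.toFun t y = y) ∧
      (∀ s' t, MapsTo (Φ.toFun t) (Q.swap.polSource s') (Q.swap.polSource s')) := by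
  have hfin : Finite (SaddlePt 2 g) := P.A.finite_saddlePt
  obtain ⟨hKc, hKT⟩ := isCompact_annulus_subset Q
  -- the plane isotopies, pushed to `∂W` along the charts `pol'_{σ s}`
  choose G δ hδ0 hδle hGs hG1 using fun s => exists_planeIsotopy_germ hk hC s (hpos s)
  have hGK : ∀ s t, ∀ y ∉ {w : E2 | 1 / 2 ≤ ‖w‖ ∧ ‖w‖ ≤ 2}, (G s).toFun t y = y := fun s t y hy =>
    hGs s t y fun h => hy ⟨h.1.le, h.2.1.le⟩
  have hT : ∀ s', {w : E2 | 1 / 2 ≤ ‖w‖ ∧ ‖w‖ ≤ 2} ⊆ (Q.swap.polarChart s' (k_swap_eq_one Q hk s')).target := fun s' => hKT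
  choose Ψ hΨ using fun s => exists_ambientIsotopy_chartTransport_of_isCompact
    (contMDiffOn_polarChart (k_swap_eq_one Q hk (Q.σ s))) (contMDiffOn_polarChart_symm (k_swap_eq_one Q hk (Q.σ s)))
    hKc (hT (Q.σ s)) (G s) (hGK s)
  -- reindex by the image saddle and compose
  set Ψ' : SaddlePt 2 g → AmbientIsotopy (𝓡 2) ((𝓡∂ (2 + 1)).boundary W) := fun s' => Ψ (Q.σ.symm s') with hΨ'
  have hdisj : Pairwise (Disjoint on fun s' => Q.swap.polSource s') := fun s₁ s₂ h => Q.swap.disjoint_polSource h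
  have hsuppΨ : ∀ s t y, y ∉ Q.swap.polSource (Q.σ s) → (Ψ s).toFun t y = y := fun s t y hy => by
    rw [hΨ s t]; exact chartTransport_of_not_mem _ hy
  have hsupp' : ∀ s' t y, y ∉ Q.swap.polSource s' → (Ψ' s').toFun t y = y := fun s' t y hy => by
    have h := hsuppΨ (Q.σ.symm s') t y
    rw [Q.σ.apply_symm_apply] at h
    exact h hy
  obtain ⟨Φ, h1, h2, h3⟩ := AmbientIsotopy.exists_forall_eqOn_of_pairwise_disjoint Ψ' (fun s' => Q.swap.polSource s') hdisj hsupp'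
  -- the value of `Φ₁` at a flow-polar point of `σ s`
  have hval : ∀ s (w : E2), w ∈ Q.polTarget → Φ.toFun 1 (Q.swap.pol (Q.σ s) w) = Q.swap.pol (Q.σ s) ((G s).toFun 1 w) := by
    intro s w hw
    have hk' := k_swap_eq_one Q hk (Q.σ s)
    have hmem : Q.swap.pol (Q.σ s) w ∈ Q.swap.polSource (Q.σ s) := pol_mem_polSource hk' hw
    rw [h1 (Q.σ s) 1 _ hmem, hΨ']
    simp only [Equiv.symm_apply_apply]
    rw [hΨ s 1, chartTransport_of_mem _ (show Q.swap.pol (Q.σ s) w ∈ (Q.swap.polarChart (Q.σ s) hk').source from hmem)]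
    simp only [polarChart_apply, polarChart_symm_apply]
    rw [polInv_pol hk' hw]
  refine ⟨Φ, fun s => ⟨δ s, hδ0 s, (hδle s).trans (by linarith [Q.sq_pos]), fun w hw hx => ?_⟩, fun s u hu => ?_, h2, h3⟩
  · -- on the thin annulus `G₁ = germ`, and `pol' ∘ germ = χ ∘ pol`
    obtain ⟨hGw, hdomw⟩ := hG1 s w hw hx
    rw [hval s w hdomw.1, hGw, germ_def]
    exact pol_polInv (k_swap_eq_one Q hk _) hdomw.2
  · -- on the circle `G₁ = germ = id`
    have hu0 : u ≠ 0 := by intro h; rw [h, norm_zero] at hu; exact zero_ne_one hu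
    have hx : xco Q.ε u ^ 2 < δ s := by rw [xco_of_norm_eq_one hu]; simpa using hδ0 s
    obtain ⟨hGu, -⟩ := hG1 s u hu0 hx
    rw [hval s u (Q.mem_polTarget_of_norm_eq_one hu), hGu, (germ_of_norm_eq_one hk hC s hu).1]

/-! ### Rigidity of the straightened map -/

include hk in
/-- **The straightened map is rigid at every saddle.**  With `Φ` as in
`exists_ambientIsotopy_normalStraighten`, the diffeomorphism `Φ₁⁻¹ ∘ χ` is the identity in
flow-polar coordinates near every trace circle, hence rigid at every saddle
(`TracePolarRigid.rigid_of_pol_eq`); and it carries the `ξ_A`-traces onto the `ξ_B`-traces as `χ`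
does. [cite: GriffithsHB1964Handlebody, §§3–6] -/
theorem exists_rigid_of_normalStraighten (hC : ∀ s (u : E2), ‖u‖ = 1 → χ (Q.pol s u) = Q.swap.pol (Q.σ s) u)
    (hpos : ∀ s (z : E2), ‖z‖ = 1 → 0 < ⟪fderiv ℝ (Q.germ χ s) z z, z⟫) :
    ∃ Φ : AmbientIsotopy (𝓡 2) ((𝓡∂ (2 + 1)).boundary W),
      (∀ s, ∃ δ : ℝ, 0 < δ ∧ Q.Rigid (χ.trans (Φ.toDiffeomorph 1).symm) s δ) ∧
      (∀ s (u : E2), ‖u‖ = 1 → Φ.toFun 1 (Q.swap.pol (Q.σ s) u) = Q.swap.pol (Q.σ s) u) ∧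
      (∀ t y, (∀ s', y ∉ Q.swap.polSource s') → Φ.toFun t y = y) := by
  obtain ⟨Φ, hann, hcirc, hsupp, -⟩ := exists_ambientIsotopy_normalStraighten hk hC hpos
  refine ⟨Φ, fun s => ?_, hcirc, hsupp⟩
  obtain ⟨δ, hδ0, hδε, hδ⟩ := hann s
  refine ⟨δ, hδ0, rigid_of_pol_eq (hk s) hδε fun w hw hx => ?_⟩
  show (Φ.toDiffeomorph 1).symm (χ (Q.pol s w)) = Q.swap.pol (Q.σ s) w
  rw [← hδ w hw hx]
  exact (Φ.toDiffeomorph 1).symm_apply_apply _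

end SaddleData

end BasinPair

end Literature.Topology.FourManifolds
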